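import Mathlib

/-!
# Dimock, *The renormalization group according to Balaban* I, §4.4 "fluctuation integral": the normalizing factor
# `𝒩_{χ,k} = exp(−ε⁰_k Vol(𝕋⁰))` and the smallness `|∫χ^w_k dμ_I − 1| ≤ 𝒪(e^{−p²_{0,k}/2})`, `ε⁰_k ≤ 𝒪(e^{−p²_{0,k}/2})` — PROVED
# with Lebesgue measure and explicit constants

**Citation header (reproduction of PUBLISHED work; template of the Bałaban lattice Yang–Mills cell).**
J. Dimock, *The renormalization group according to Balaban I. Small fields*, Rev. Math. Phys. **25** (2013) 1330010
(= arXiv:1108.1335v2) [Dimock2013], §4.1 (the characteristic functions) TeX L1875–1888, §4.4 "fluctuation integral"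
L2217–2252 (TeX source held by the cell, `inputs/files/dimock/src/1108.1335/1108.1335.tex`, 7382e6540dded9be);
J. Dimock, *… II. Large fields*, J. Math. Phys. **54** (2013) 092301 (= arXiv:1212.5562v2) [Dimock2013BalabanII], §3.3
L4384–4393 (`…/1212.5562/1212.5562.tex`, 75c5792fc48eacbc).  Dimock's papers are published and refereed and are the
cell's TEMPLATE, not manuscripts under audit; no quantity of the Bałaban series is touched.

**What the paper prints (verbatim).**  I L1875–1878: *"Here the characterstic functions are χ^w_k(W) = χ(|W| ≤ p_{0,k})"*;
L1884–1888: *"The size is determined by p_{0,k} = p₀(λ_k) = (−log λ_k)^{p₀}  This has the same form as p_k but with a smaller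
integer exponent p₀ < p."*  L2065–2067: *"… changing from Gaussian Z : 𝕋⁰_{𝖬+𝖭−k} → ℝ with covariance C_k to Z = C_k^{1/2}W
where Gaussian W : 𝕋⁰_{𝖬+𝖭−k} → ℝ has covariance I"* (the measure `dμ_I(W)`).  §4.4 L2230–2252: *"We make a couple of
adjustments in Ξ_k. First change to the probability measure dμ*_k(W) = 𝒩_{χ,k}^{−1} χ^w_k(W) dμ_I(W)  Here the normalizing
factor is 𝒩_{χ,k} = ∫χ^w_k(W) dμ_I(W) = Π_{x∈𝕋⁰_{𝖬+𝖭−k}} ∫χ^w_k(W(x)) dμ_I(W(x)) = Π_{x∈𝕋⁰_{𝖬+𝖭−k}} exp(−ε⁰_k) =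
exp(−ε⁰_k Vol(𝕋⁰_{𝖬+𝖭−k})) where ε⁰_k > 0 is defined by ε⁰_k = −log(∫χ^w_k(W(x)) dμ_I(W(x)))  It is straightforward to
show |∫χ^w_k(W(x)) dμ_I(W(x)) − 1| ≤ 𝒪(e^{−p²_{0,k}/2}) and hence ε⁰_k ≤ 𝒪(e^{−p²_{0,k}/2}) as well. It is very small"*.
II L4388–4393: *"Since the measure is a product over sites in Λ^{(k)}_{k+1}, the normalization factor can be written
𝒩^w_{k,Λ_{k+1}} = ∫χ^w_k(Λ_{k+1}) dμ_{Λ_{k+1}}(W_k) = exp(−ε⁰_k|Λ^{(k)}_{k+1}|) = exp(−ε⁰_k Vol(Λ_{k+1}))  This defines ε⁰_k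
which is the same as in part I."*

**What is reproduced here (kernel-checked, zero `sorry`; Mathlib only).**  The unit Gaussian measure `μ_I` on one site is
written as the density `(2π)^{−1/2} e^{−w²/2}` against Lebesgue `volume` on `ℝ`, and on the sites `X` (any `Fintype`) as the
product density against `volume` on `X → ℝ`.
* §1 `chiW p w` = χ(|w| ≤ p) ∈ {0,1}; `gaussDensity w = (√(2π))⁻¹ e^{−w²/2}` with `∫ gaussDensity = 1` (`integral_gaussDensity`,
  from Mathlib's `integral_gaussian`); `siteMass p := ∫ w, chiW p w · gaussDensity w` (= `∫χ^w_k(W(x)) dμ_I(W(x))`);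
  `eps0 p := −log(siteMass p)` (= `ε⁰_k` at `p = p_{0,k}`).
* §2 **the tail bound with an explicit constant** (`one_sub_siteMass_le`): for `p ≥ 0`,
  `0 ≤ 1 − siteMass p ≤ 2 e^{−p²/2}`, hence `|siteMass p − 1| ≤ 2 e^{−p²/2}` (`abs_siteMass_sub_one_le`) — the printed
  *"|∫χ^w_k dμ_I − 1| ≤ 𝒪(e^{−p²_{0,k}/2})"* with `𝒪 = 2`.  Proof: `1 − siteMass p = ∫ 1_{|w|>p} · gaussDensity`, the pointwise
  bound `1_{|w|>p} e^{−w²/2} ≤ e^{−p²/2}(e^{−(w−p)²/2} + e^{−(w+p)²/2})` (for `w > p ≥ 0`, `w² ≥ (w−p)² + p²`; symmetrically for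
  `w < −p`), translation invariance of Lebesgue measure and `∫e^{−w²/2} = √(2π)`.
* §3 **`ε⁰`** : `siteMass_le_one`, `eps0_nonneg` (*"ε⁰_k > 0"* in the weak form `≥ 0`), and (`eps0_le`) under `4e^{−p²/2} ≤ 1`
  (so that `siteMass p ≥ ½`): `eps0 p ≤ 2(1 − siteMass p) ≤ 4 e^{−p²/2}` — *"hence ε⁰_k ≤ 𝒪(e^{−p²_{0,k}/2}) as well"* with
  `𝒪 = 4` (`−log N ≤ N⁻¹ − 1`, Mathlib's `Real.log_le_sub_one_of_pos`).
* §4 **the factorisation** (`normalizer_eq_pow`, `normalizer_eq_exp`): `∫ (W : X → ℝ), Π_x chiW p (W x) · gaussDensity (W x)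
  = (siteMass p)^{|X|} = exp(−eps0 p · |X|)` — *"𝒩_{χ,k} = Π_x ∫χ^w_k(W(x)) dμ_I(W(x)) = exp(−ε⁰_k Vol(𝕋⁰))"* (Mathlib's
  `integral_fintype_prod_volume_eq_pow`; the second form needs `siteMass p > 0`, supplied by §3's hypothesis).
* §5 a numerical instance.

**Readings (declared).**  (i) `dμ_I` = the product of standard normal laws, written as a density against Lebesgue
measure; `χ^w_k(W) = Π_x χ(|W(x)| ≤ p_{0,k})` (the sup-norm condition `|W| ≤ p_{0,k}` site by site, as the product formula
L2238–2239 uses).  (ii) The constants `2` and `4` are this file's; the print says `𝒪(·)`.  (iii) `ε⁰_k > 0` strictly would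
need `siteMass p < 1` (true for every finite `p`; not pursued — only `≥ 0` and the upper bound are used downstream).

**What is NOT claimed.**  The rest of §4.4 (δE⁺_k, LEMMA 12 (unsung) onwards, the cluster expansion of Ξ′_k), the
change of variables `Z = C_k^{1/2}W` (L2065–2080), the choice `p_{0,k} = (−log λ_k)^{p₀}` and "very small" as a comparison
with other constants; anything of B1–B16 (TEMPLATE.md §4.1 row «D1 §4.4» ↔ B11 §3).  NOT summit progress; NOT a statement
about any Bałaban paper; NOT continuum; NOT Clay.  Unit `b2b-balaban-template` gen 30 (journal CLAIM
D1-FLUCTUATION-NORMALIZER-KERNEL).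

**Version.**  v1.
-/

noncomputable section

open MeasureTheory Real Finset

namespace Literature.MathematicalPhysics.QuantumFieldTheory.Dimock2011to13.FluctuationNormalizer

/-! ## §1 The objects: `χ^w`, the unit Gaussian density, the per-site mass and `ε⁰` -/

/-- `χ^w_k(W) = χ(|W| ≤ p_{0,k})` at one site. [cite: Dimock2013, §4.1 L1878 (arXiv:1108.1335v2 TeX)] -/
def chiW (p w : ℝ) : ℝ := if |w| ≤ p then 1 else 0

/-- the complementary indicator `1 − χ^w = χ(|W| > p)`. [cite: Dimock2013, §4.1 L1878 (arXiv:1108.1335v2 TeX)] -/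
def tailInd (p w : ℝ) : ℝ := if p < |w| then 1 else 0

/-- the density of the unit Gaussian measure `dμ_I` at one site: `(2π)^{−1/2} e^{−w²/2}`. [cite: Dimock2013, §4.4
L2065–2067 (arXiv:1108.1335v2 TeX)] -/
def gaussDensity (w : ℝ) : ℝ := (√(2 * π))⁻¹ * Real.exp (-(w ^ 2 / 2))

/-- the per-site mass `∫ χ^w_k(W(x)) dμ_I(W(x))`. [cite: Dimock2013, §4.4 L2239 and L2246 (arXiv:1108.1335v2 TeX)] -/
def siteMass (p : ℝ) : ℝ := ∫ w, chiW p w * gaussDensity w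

/-- `ε⁰_k = −log(∫ χ^w_k(W(x)) dμ_I(W(x)))`. [cite: Dimock2013, §4.4 L2244–2247 (arXiv:1108.1335v2 TeX); Dimock2013BalabanII
§3.3 L4390–4393] -/
def eps0 (p : ℝ) : ℝ := -Real.log (siteMass p)

/-- `χ^w ≥ 0`. [cite: Dimock2013, §4.1 L1878 (arXiv:1108.1335v2 TeX)] -/
theorem chiW_nonneg (p w : ℝ) : 0 ≤ chiW p w := by unfold chiW; split_ifs <;> norm_num

/-- `χ^w ≤ 1`. [cite: Dimock2013, §4.1 L1878 (arXiv:1108.1335v2 TeX)] -/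
theorem chiW_le_one (p w : ℝ) : chiW p w ≤ 1 := by unfold chiW; split_ifs <;> norm_num

/-- `χ(|w| ≤ p) + χ(|w| > p) = 1`. [cite: Dimock2013, §4.1 L1878 (arXiv:1108.1335v2 TeX)] -/
theorem chiW_add_tailInd (p w : ℝ) : chiW p w + tailInd p w = 1 := by
  unfold chiW tailInd
  by_cases h : |w| ≤ p
  · rw [if_pos h, if_neg (not_lt.mpr h)]; ring
  · rw [if_neg h, if_pos (not_le.mp h)]; ring

/-- `χ(|w| > p) ≥ 0`. [cite: Dimock2013, §4.1 L1878 (arXiv:1108.1335v2 TeX)] -/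
theorem tailInd_nonneg (p w : ℝ) : 0 ≤ tailInd p w := by unfold tailInd; split_ifs <;> norm_num

/-- the Gaussian density is positive. [cite: Dimock2013, §4.4 L2065–2067 (arXiv:1108.1335v2 TeX)] -/
theorem gaussDensity_pos (w : ℝ) : 0 < gaussDensity w := by unfold gaussDensity; positivity

/-- `∫ e^{−w²/2} dw = √(2π)` (Mathlib's `integral_gaussian` at `b = ½`). [folklore] -/
private theorem integral_exp_neg_half_sq : ∫ w : ℝ, Real.exp (-(w ^ 2 / 2)) = √(2 * π) := by
  have h := integral_gaussian (1 / 2 : ℝ)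
  have h2 : (fun x : ℝ => Real.exp (-(1 / 2) * x ^ 2)) = fun x => Real.exp (-(x ^ 2 / 2)) := by
    funext x; congr 1; ring
  rw [h2] at h
  rw [h]; congr 1; field_simp

/-- integrability of `e^{−w²/2}` (Mathlib's `integrable_exp_neg_mul_sq`). [folklore] -/
private theorem integrable_exp_neg_half_sq : Integrable fun w : ℝ => Real.exp (-(w ^ 2 / 2)) := by
  have h := integrable_exp_neg_mul_sq (b := (1 / 2 : ℝ)) (by norm_num)
  refine h.congr (Filter.Eventually.of_forall fun x => ?_)
  simp only; congr 1; ring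

/-- the Gaussian density is integrable. [cite: Dimock2013, §4.4 L2065–2067 (arXiv:1108.1335v2 TeX)] -/
theorem integrable_gaussDensity : Integrable gaussDensity :=
  integrable_exp_neg_half_sq.const_mul _

/-- `μ_I` is a probability measure: `∫ (2π)^{−1/2} e^{−w²/2} dw = 1`. [cite: Dimock2013, §4.4 L2065–2067 (arXiv:1108.1335v2 TeX)] -/
theorem integral_gaussDensity : ∫ w, gaussDensity w = 1 := by
  unfold gaussDensity
  rw [integral_const_mul, integral_exp_neg_half_sq, inv_mul_cancel₀]
  positivity

/-- measurability of the indicator-type step functions used here. [folklore] -/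
private theorem measurable_ite_le (p : ℝ) : Measurable fun w : ℝ => (if |w| ≤ p then (1 : ℝ) else 0) := by
  refine Measurable.ite ?_ measurable_const measurable_const
  exact measurableSet_le (by fun_prop) measurable_const

/-- measurability of `χ(|w| > p)`. [folklore] -/
private theorem measurable_ite_lt (p : ℝ) : Measurable fun w : ℝ => (if p < |w| then (1 : ℝ) else 0) := by
  refine Measurable.ite ?_ measurable_const measurable_const
  exact measurableSet_lt measurable_const (by fun_prop)

/-- `χ^w dμ_I` is a finite measure (integrability of the density). [cite: Dimock2013, §4.4 L2238–2239 (arXiv:1108.1335v2 TeX)] -/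
theorem integrable_chiW_mul (p : ℝ) : Integrable fun w => chiW p w * gaussDensity w := by
  refine Integrable.bdd_mul (c := 1) integrable_gaussDensity (measurable_ite_le p).aestronglyMeasurable
    (Filter.Eventually.of_forall fun w => ?_)
  rw [Real.norm_eq_abs, abs_of_nonneg (chiW_nonneg p w)]
  exact chiW_le_one p w

/-- `χ(|w| > p) ≤ 1`. [cite: Dimock2013, §4.1 L1878 (arXiv:1108.1335v2 TeX)] -/
theorem tailInd_le_one (p w : ℝ) : tailInd p w ≤ 1 := by unfold tailInd; split_ifs <;> norm_num

/-- `χ(|w| > p) dμ_I` is a finite measure. [cite: Dimock2013, §4.4 L2249–2251 (arXiv:1108.1335v2 TeX)] -/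
theorem integrable_tailInd_mul (p : ℝ) : Integrable fun w => tailInd p w * gaussDensity w := by
  refine Integrable.bdd_mul (c := 1) integrable_gaussDensity (measurable_ite_lt p).aestronglyMeasurable
    (Filter.Eventually.of_forall fun w => ?_)
  rw [Real.norm_eq_abs, abs_of_nonneg (tailInd_nonneg p w)]
  exact tailInd_le_one p w

/-! ## §2 The tail bound: `|∫χ^w_k dμ_I − 1| ≤ 2e^{−p²/2}` -/

/-- `1 − siteMass p = ∫ χ(|w| > p) dμ_I(w)`. [cite: Dimock2013, §4.4 L2249–2251 (arXiv:1108.1335v2 TeX)] -/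
theorem one_sub_siteMass (p : ℝ) : 1 - siteMass p = ∫ w, tailInd p w * gaussDensity w := by
  rw [← integral_gaussDensity, siteMass, ← integral_sub integrable_gaussDensity (integrable_chiW_mul p)]
  refine integral_congr_ae (Filter.Eventually.of_forall fun w => ?_)
  have h := chiW_add_tailInd p w
  simp only
  calc gaussDensity w - chiW p w * gaussDensity w = (1 - chiW p w) * gaussDensity w := by ring
    _ = tailInd p w * gaussDensity w := by rw [show 1 - chiW p w = tailInd p w by linarith]

/-- the pointwise bound behind the tail estimate: for `p ≥ 0`,
`χ(|w| > p) e^{−w²/2} ≤ e^{−p²/2}(e^{−(w−p)²/2} + e^{−(w+p)²/2})`. [folklore] -/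
private theorem tail_pointwise {p : ℝ} (hp : 0 ≤ p) (w : ℝ) :
    tailInd p w * Real.exp (-(w ^ 2 / 2))
      ≤ Real.exp (-(p ^ 2 / 2)) * (Real.exp (-((w - p) ^ 2 / 2)) + Real.exp (-((w + p) ^ 2 / 2))) := by
  have hR : 0 ≤ Real.exp (-(p ^ 2 / 2)) * (Real.exp (-((w - p) ^ 2 / 2)) + Real.exp (-((w + p) ^ 2 / 2))) := by
    positivity
  unfold tailInd
  split_ifs with h
  · rw [one_mul]
    rcases lt_abs.mp h with hw | hw
    · -- w > p ≥ 0: w² ≥ (w − p)² + p²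
      have key : (w - p) ^ 2 / 2 + p ^ 2 / 2 ≤ w ^ 2 / 2 := by nlinarith
      calc Real.exp (-(w ^ 2 / 2)) ≤ Real.exp (-(p ^ 2 / 2)) * Real.exp (-((w - p) ^ 2 / 2)) := by
            rw [← Real.exp_add, Real.exp_le_exp]; linarith
        _ ≤ _ := by
            refine mul_le_mul_of_nonneg_left ?_ (Real.exp_pos _).le
            linarith [Real.exp_pos (-((w + p) ^ 2 / 2))]
    · -- w < −p ≤ 0: w² ≥ (w + p)² + p²
      have key : (w + p) ^ 2 / 2 + p ^ 2 / 2 ≤ w ^ 2 / 2 := by nlinarith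
      calc Real.exp (-(w ^ 2 / 2)) ≤ Real.exp (-(p ^ 2 / 2)) * Real.exp (-((w + p) ^ 2 / 2)) := by
            rw [← Real.exp_add, Real.exp_le_exp]; linarith
        _ ≤ _ := by
            refine mul_le_mul_of_nonneg_left ?_ (Real.exp_pos _).le
            linarith [Real.exp_pos (-((w - p) ^ 2 / 2))]
  · rw [zero_mul]; exact hR

/-- `0 ≤ 1 − siteMass p`, i.e. `siteMass p ≤ 1`. [cite: Dimock2013, §4.4 L2249–2251 (arXiv:1108.1335v2 TeX)] -/
theorem siteMass_le_one (p : ℝ) : siteMass p ≤ 1 := by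
  have h := one_sub_siteMass p
  have h0 : 0 ≤ ∫ w, tailInd p w * gaussDensity w :=
    integral_nonneg fun w => mul_nonneg (tailInd_nonneg p w) (gaussDensity_pos w).le
  linarith

/-- **THE TAIL BOUND**: for `p ≥ 0`, `1 − ∫χ(|w| ≤ p) dμ_I(w) ≤ 2 e^{−p²/2}` — the printed *"|∫χ^w_k(W(x)) dμ_I(W(x)) − 1| ≤
𝒪(e^{−p²_{0,k}/2})"* with the explicit constant `2`. [cite: Dimock2013, §4.4 L2248–2251 (arXiv:1108.1335v2 TeX)] -/
theorem one_sub_siteMass_le {p : ℝ} (hp : 0 ≤ p) : 1 - siteMass p ≤ 2 * Real.exp (-(p ^ 2 / 2)) := by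
  rw [one_sub_siteMass]
  have hint1 : Integrable fun w : ℝ => Real.exp (-((w - p) ^ 2 / 2)) :=
    integrable_exp_neg_half_sq.comp_sub_right p
  have hint2 : Integrable fun w : ℝ => Real.exp (-((w + p) ^ 2 / 2)) := by
    have := integrable_exp_neg_half_sq.comp_sub_right (-p)
    refine this.congr (Filter.Eventually.of_forall fun w => ?_); simp only [sub_neg_eq_add]
  have hI1 : ∫ w : ℝ, Real.exp (-((w - p) ^ 2 / 2)) = √(2 * π) := by
    rw [integral_sub_right_eq_self (μ := volume) (fun w : ℝ => Real.exp (-(w ^ 2 / 2))) p]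
    exact integral_exp_neg_half_sq
  have hI2 : ∫ w : ℝ, Real.exp (-((w + p) ^ 2 / 2)) = √(2 * π) := by
    rw [integral_add_right_eq_self (μ := volume) (fun w : ℝ => Real.exp (-(w ^ 2 / 2))) p]
    exact integral_exp_neg_half_sq
  have hsq : (0 : ℝ) < √(2 * π) := by positivity
  calc ∫ w, tailInd p w * gaussDensity w
      = (√(2 * π))⁻¹ * ∫ w, tailInd p w * Real.exp (-(w ^ 2 / 2)) := by
        rw [← integral_const_mul]
        refine integral_congr_ae (Filter.Eventually.of_forall fun w => ?_)
        simp only [gaussDensity]; ring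
    _ ≤ (√(2 * π))⁻¹ * ∫ w, Real.exp (-(p ^ 2 / 2))
          * (Real.exp (-((w - p) ^ 2 / 2)) + Real.exp (-((w + p) ^ 2 / 2))) := by
        refine mul_le_mul_of_nonneg_left ?_ (inv_pos.mpr hsq).le
        refine integral_mono_of_nonneg (Filter.Eventually.of_forall fun w => ?_)
          ((hint1.add hint2).const_mul _) (Filter.Eventually.of_forall fun w => tail_pointwise hp w)
        exact mul_nonneg (tailInd_nonneg p w) (Real.exp_pos _).le
    _ = (√(2 * π))⁻¹ * (Real.exp (-(p ^ 2 / 2)) * (√(2 * π) + √(2 * π))) := by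
        rw [integral_const_mul, integral_add hint1 hint2, hI1, hI2]
    _ = 2 * Real.exp (-(p ^ 2 / 2)) := by field_simp; ring

/-- the printed form: `|∫χ^w_k(W(x)) dμ_I(W(x)) − 1| ≤ 2 e^{−p²_{0,k}/2}` (`p_{0,k} ≥ 0`). [cite: Dimock2013, §4.4 L2248–2251
(arXiv:1108.1335v2 TeX)] -/
theorem abs_siteMass_sub_one_le {p : ℝ} (hp : 0 ≤ p) : |siteMass p - 1| ≤ 2 * Real.exp (-(p ^ 2 / 2)) := by
  rw [abs_sub_comm, abs_of_nonneg (by linarith [siteMass_le_one p])]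
  exact one_sub_siteMass_le hp

/-! ## §3 `ε⁰_k ≥ 0` and `ε⁰_k ≤ 𝒪(e^{−p²_{0,k}/2})` -/

/-- under `4e^{−p²/2} ≤ 1` the per-site mass is at least `½` (in particular positive). [cite: Dimock2013, §4.4 L2248–2252
(arXiv:1108.1335v2 TeX)] -/
theorem half_le_siteMass {p : ℝ} (hp : 0 ≤ p) (hsmall : 4 * Real.exp (-(p ^ 2 / 2)) ≤ 1) : 1 / 2 ≤ siteMass p := by
  have h := one_sub_siteMass_le hp
  linarith

/-- `ε⁰_k ≥ 0` (the print: *"ε⁰_k > 0"*; here the weak inequality, from `siteMass ≤ 1`), under the positivity hypothesis.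
[cite: Dimock2013, §4.4 L2244 (arXiv:1108.1335v2 TeX)] -/
theorem eps0_nonneg {p : ℝ} (hp : 0 ≤ p) (hsmall : 4 * Real.exp (-(p ^ 2 / 2)) ≤ 1) : 0 ≤ eps0 p := by
  unfold eps0
  have hpos : 0 < siteMass p := by linarith [half_le_siteMass hp hsmall]
  rw [neg_nonneg]
  exact Real.log_nonpos hpos.le (siteMass_le_one p)

/-- **`ε⁰_k ≤ 𝒪(e^{−p²_{0,k}/2})`**: under `4e^{−p²/2} ≤ 1`, `ε⁰ = −log(siteMass p) ≤ 2(1 − siteMass p) ≤ 4 e^{−p²/2}` — *"and hence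
ε⁰_k ≤ 𝒪(e^{−p²_{0,k}/2}) as well. It is very small"*. [cite: Dimock2013, §4.4 L2248–2252 (arXiv:1108.1335v2 TeX)] -/
theorem eps0_le {p : ℝ} (hp : 0 ≤ p) (hsmall : 4 * Real.exp (-(p ^ 2 / 2)) ≤ 1) :
    eps0 p ≤ 4 * Real.exp (-(p ^ 2 / 2)) := by
  have hhalf := half_le_siteMass hp hsmall
  have hpos : 0 < siteMass p := by linarith
  have htail := one_sub_siteMass_le hp
  -- −log N = log N⁻¹ ≤ N⁻¹ − 1 = (1 − N)/N ≤ 2(1 − N)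
  have h1 : eps0 p ≤ (siteMass p)⁻¹ - 1 := by
    unfold eps0
    rw [← Real.log_inv]
    exact Real.log_le_sub_one_of_pos (inv_pos.mpr hpos)
  have h2 : (siteMass p)⁻¹ - 1 = (1 - siteMass p) / siteMass p := by field_simp
  have h3 : (1 - siteMass p) / siteMass p ≤ 2 * (1 - siteMass p) := by
    rw [div_le_iff₀ hpos]
    nlinarith [siteMass_le_one p]
  linarith

/-! ## §4 The factorisation `𝒩_{χ,k} = Π_x ∫χ^w_k(W(x)) dμ_I(W(x)) = exp(−ε⁰_k Vol(𝕋⁰))` -/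

variable {X : Type*} [Fintype X]

/-- **`𝒩_{χ,k} = Π_x ∫χ^w_k(W(x)) dμ_I(W(x))`** = `(siteMass p)^{|X|}`: the product structure of `χ^w_k dμ_I` over the sites
(Fubini for the finite product of Lebesgue measures). [cite: Dimock2013, §4.4 L2236–2243 (arXiv:1108.1335v2 TeX);
Dimock2013BalabanII §3.3 L4388–4392] -/
theorem normalizer_eq_pow (p : ℝ) :
    ∫ W : X → ℝ, ∏ x, chiW p (W x) * gaussDensity (W x) = siteMass p ^ Fintype.card X := by
  rw [siteMass]
  exact integral_fintype_prod_volume_eq_pow (fun w => chiW p w * gaussDensity w)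

/-- **`𝒩_{χ,k} = exp(−ε⁰_k Vol(𝕋⁰_{𝖬+𝖭−k}))`** (`Vol` = the number of unit-lattice sites), under the positivity hypothesis of §3.
[cite: Dimock2013, §4.4 L2236–2247 (arXiv:1108.1335v2 TeX); Dimock2013BalabanII §3.3 L4388–4393] -/
theorem normalizer_eq_exp {p : ℝ} (hp : 0 ≤ p) (hsmall : 4 * Real.exp (-(p ^ 2 / 2)) ≤ 1) :
    ∫ W : X → ℝ, ∏ x, chiW p (W x) * gaussDensity (W x) = Real.exp (-(eps0 p * Fintype.card X)) := by
  have hpos : 0 < siteMass p := by linarith [half_le_siteMass hp hsmall]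
  rw [normalizer_eq_pow, eps0, neg_mul, neg_neg, mul_comm, Real.exp_nat_mul, Real.exp_log hpos]

/-- the normalised measure `dμ*_k = 𝒩_{χ,k}^{−1} χ^w_k dμ_I` has total mass one (restated: the normalizer is positive and the
ratio is `1`). [cite: Dimock2013, §4.4 L2231–2234 (arXiv:1108.1335v2 TeX)] -/
theorem normalizer_pos {p : ℝ} (hp : 0 ≤ p) (hsmall : 4 * Real.exp (-(p ^ 2 / 2)) ≤ 1) :
    0 < ∫ W : X → ℝ, ∏ x, chiW p (W x) * gaussDensity (W x) := by
  rw [normalizer_eq_exp hp hsmall]; exact Real.exp_pos _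

/-! ## §5 Instance -/

/-- With `p = 2`: `4e^{−2} ≤ 1` (since `e ≥ 2`), so all of §3–§4 apply: `0 ≤ ε⁰ ≤ 4e^{−2}` and
`|∫χ(|w| ≤ 2) dμ_I − 1| ≤ 2e^{−2}`. -/
example : eps0 2 ≤ 4 * Real.exp (-(2 ^ 2 / 2)) ∧ |siteMass 2 - 1| ≤ 2 * Real.exp (-(2 ^ 2 / 2)) := by
  have hsmall : 4 * Real.exp (-((2 : ℝ) ^ 2 / 2)) ≤ 1 := by
    have h1 : Real.exp (-((2 : ℝ) ^ 2 / 2)) = (Real.exp 1 * Real.exp 1)⁻¹ := by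
      rw [← Real.exp_add, ← Real.exp_neg]; norm_num
    rw [h1]
    have he : (2 : ℝ) ≤ Real.exp 1 := by
      have := Real.add_one_le_exp (1 : ℝ); linarith
    have h4 : (4 : ℝ) ≤ Real.exp 1 * Real.exp 1 := by nlinarith [Real.exp_pos (1 : ℝ)]
    rw [mul_inv_le_iff₀ (by positivity)]; linarith
  exact ⟨eps0_le (by norm_num) hsmall, abs_siteMass_sub_one_le (by norm_num)⟩

end Literature.MathematicalPhysics.QuantumFieldTheory.Dimock2011to13.FluctuationNormalizer

end
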